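import Mathlib
import Literature.AlgebraicGeometry.Tropical.InitialIdeal
import Summits.ResolutionOfSingularities.ResolutionOfSingularities.Theorems.TropicalLinksInductiveStepOffTropical

/-!
# Crux `InductiveStep` (stmt-ResolutionOfSingularities-17233) — negative knowledge, part 1/2: the kernel
# lemma at the LEG weight of a tropical modification

Route `ResolutionOfSingularities/TropicalLinks`, crux `InductiveStep`, line `split` (cdisprove seat, gen 2 /
cycle 1).  Datum: `N = m = 1`, `I = ⊥ ⊆ k[x^±]` (`U = 𝔾_m`, prime, `d = 1`), unit `G₀ = x − 1 ∉ I`,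
re-embedding `I' = ⟨ι(⊥), z − ι(x − 1)⟩ = ⟨z − x + 1⟩ ⊆ k[x^±, z^±] = k[ℤ^(1+1)]`, weight `w = (0, 1)`
(the weight `1` of `z` lies STRICTLY ABOVE the weight `0` of both monomials of `G₀`).

* `inductiveStep_leg_inIdeal_le_ker` — the route's inlined initial ideal `in_w(I')` is contained in the
  kernel of every `k`-algebra map `k[x^±, z^±] → k[z^±]`, `x ↦ 1, z ↦ z`.  Proof (the `(X−1)`-adic
  valuation, i.e. WHY `(0,1) ∈ Trop(U[G⁻¹])`): every `f ∈ I'` dies under `x ↦ X, z ↦ X − 1` into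
  `Frac k[X^±]`; multiplying by `(X − 1)^(−min)` and evaluating at `X = 1`
  (`inductiveStep_leg_layer_sum_eq_zero`, `inductiveStep_leg_bottom_layer_sum_eq_zero`) shows that the
  bottom `w`-layer of `f` — which is `in_w(f)` — has coefficient sum `0`, i.e. dies at `x = 1`.
* `inductiveStep_leg_exists_subst` — such a substitution map exists (so the bound is not vacuous).
* the bridge `Theorems.tropicalLinks_weightInitialIdeal_eq_span` (landed, p160703) to
  `Literature…Tropical.weightInitialIdeal` is reused (decidability instance explicit: the route's term
  carries the classical one; cf. `NotInductiveStepIff.lean`, trap T1); `inductiveStep_leg_dotWeight` — `⟨(0,1), v⟩ = v₁`.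

Consequences (`in_w(I') ≠ ⊤`, `∋ x − 1`, `∌ z − x + 1`, and the REFUTATION of "above the graph ⇒
`in_w(I') = ⊤`" under all guards of the crux) are in part 2/2, `AboveGraphNotVacuous.lean`.
-/

-- single-problem summit: the doubled namespace component `ResolutionOfSingularities` is forced
set_option linter.dupNamespace false

namespace Summit.ResolutionOfSingularities.ResolutionOfSingularities.Theorems.InductiveStep.Negative

open AddMonoidAlgebra Literature.AlgebraicGeometry.Tropical
open scoped Classical

/-- Step A (pure algebra in the Laurent polynomial ring `k[x^±] = k[ℤ¹]`): if a finite family of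
coefficients `c v`, `v ∈ S ⊆ ℤ^(1+1)`, satisfies `Σ_v c_v · x^(v₀) · (x − 1)^(v₁ − μ₀) = 0` in `k[x^±]`,
where `μ₀ ≤ v₁` on `S`, then the coefficients on the bottom layer `v₁ = μ₀` sum to zero
(evaluate at `x = 1`). [folklore] -/
theorem inductiveStep_leg_bottom_layer_sum_eq_zero (k : Type) [Field k]
    (S : Finset (Fin (1 + 1) → ℤ)) (c : (Fin (1 + 1) → ℤ) → k) (μ₀ : ℤ)
    (hμ : ∀ v ∈ S, μ₀ ≤ v (Fin.natAdd 1 0))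
    (h : ∑ v ∈ S, single (0 : Fin 1 → ℤ) (c v) *
        (single (fun _ : Fin 1 => v (Fin.castAdd 1 0)) (1 : k) *
          (single (1 : Fin 1 → ℤ) (1 : k) - 1) ^ (v (Fin.natAdd 1 0) - μ₀).toNat) = 0) :
    ∑ v ∈ S.filter (fun v => v (Fin.natAdd 1 0) = μ₀), c v = 0 := by
  -- evaluate at `x = 1`: the augmentation `ε : k[ℤ¹] →ₐ[k] k`, every monomial `↦ 1`
  let ε : AddMonoidAlgebra k (Fin 1 → ℤ) →ₐ[k] k := AddMonoidAlgebra.lift k k (Fin 1 → ℤ) 1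
  have hε_single : ∀ (v : Fin 1 → ℤ) (a : k), ε (single v a) = a := by
    intro v a
    simp [ε]
  have hε_x : ε (single (1 : Fin 1 → ℤ) (1 : k) - 1) = 0 := by
    rw [map_sub, hε_single, map_one, sub_self]
  have h1 := congrArg ε h
  rw [map_sum, map_zero] at h1
  simp only [map_mul, map_pow, hε_single, hε_x, one_mul] at h1
  rw [← Finset.sum_filter_add_sum_filter_not S (fun v => v (Fin.natAdd 1 0) = μ₀)] at h1
  have hA : ∀ v ∈ S.filter (fun v => v (Fin.natAdd 1 0) = μ₀),
      c v * (0 : k) ^ (v (Fin.natAdd 1 0) - μ₀).toNat = c v := by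
    intro v hv
    rw [Finset.mem_filter] at hv
    rw [hv.2, sub_self, Int.toNat_zero, pow_zero, mul_one]
  have hB : ∀ v ∈ S.filter (fun v => ¬ v (Fin.natAdd 1 0) = μ₀),
      c v * (0 : k) ^ (v (Fin.natAdd 1 0) - μ₀).toNat = 0 := by
    intro v hv
    rw [Finset.mem_filter] at hv
    have hlt : μ₀ < v (Fin.natAdd 1 0) := lt_of_le_of_ne (hμ v hv.1) (Ne.symm hv.2)
    have hpos : (v (Fin.natAdd 1 0) - μ₀).toNat ≠ 0 := by
      intro h0
      rw [Int.toNat_eq_zero] at h0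
      omega
    rw [zero_pow hpos, mul_zero]
  rw [Finset.sum_congr rfl hA, Finset.sum_congr rfl hB, Finset.sum_const_zero, add_zero] at h1
  exact h1


/-- Step B (the `(x − 1)`-adic valuation): in a field `K` containing `k[x^±] = k[ℤ¹]`, if
`Σ_{v ∈ S} c_v · x^(v₀) · (x − 1)^(v₁) = 0` (integer exponents of the units `x`, `x − 1` of `K`),
then the coefficients on the bottom layer `v₁ = min` sum to zero: multiply by `(x − 1)^(−min)`, land
in `k[x^±]`, evaluate at `x = 1` (Step A). [folklore] -/
theorem inductiveStep_leg_layer_sum_eq_zero (k : Type) [Field k] (K : Type) [Field K]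
    [Algebra (AddMonoidAlgebra k (Fin 1 → ℤ)) K]
    (hinj : Function.Injective (algebraMap (AddMonoidAlgebra k (Fin 1 → ℤ)) K))
    (S : Finset (Fin (1 + 1) → ℤ)) (hS : S.Nonempty) (c : (Fin (1 + 1) → ℤ) → k)
    (h : ∑ v ∈ S, algebraMap (AddMonoidAlgebra k (Fin 1 → ℤ)) K (single (0 : Fin 1 → ℤ) (c v)) *
        (algebraMap (AddMonoidAlgebra k (Fin 1 → ℤ)) K (single (1 : Fin 1 → ℤ) (1 : k)) ^
            (v (Fin.castAdd 1 0)) *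
          (algebraMap (AddMonoidAlgebra k (Fin 1 → ℤ)) K (single (1 : Fin 1 → ℤ) (1 : k)) - 1) ^
            (v (Fin.natAdd 1 0))) = 0) :
    ∑ v ∈ S.filter (fun v => v (Fin.natAdd 1 0) = S.inf' hS (fun v => v (Fin.natAdd 1 0))),
      c v = 0 := by
  set R₁ := AddMonoidAlgebra k (Fin 1 → ℤ) with hR₁
  set xR : AddMonoidAlgebra k (Fin 1 → ℤ) := single (1 : Fin 1 → ℤ) (1 : k) with hxR
  set X : K := algebraMap (AddMonoidAlgebra k (Fin 1 → ℤ)) K xR with hX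
  set μ₀ : ℤ := S.inf' hS (fun v => v (Fin.natAdd 1 0)) with hμ₀
  have hμ : ∀ v ∈ S, μ₀ ≤ v (Fin.natAdd 1 0) := fun v hv =>
    Finset.inf'_le (fun v : Fin (1 + 1) → ℤ => v (Fin.natAdd 1 0)) hv
  have hX0 : X ≠ 0 := by
    intro h0
    have h1 : xR = 0 := hinj (by rw [map_zero]; exact h0)
    rw [hxR, single_eq_zero] at h1
    exact one_ne_zero h1
  have hU0 : X - 1 ≠ 0 := by
    intro h0
    have h1 : xR = 1 := hinj (by rw [map_one]; exact sub_eq_zero.1 h0)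
    have h2 := congrArg (fun g : AddMonoidAlgebra k (Fin 1 → ℤ) => g.coeff (1 : Fin 1 → ℤ)) h1
    have h10 : (1 : Fin 1 → ℤ) ≠ 0 := fun h => one_ne_zero (congrFun h 0)
    simp only [hxR, one_def, coeff_single, Finsupp.single_eq_same] at h2
    rw [Finsupp.single_eq_of_ne h10] at h2
    exact one_ne_zero h2
  -- integer powers of `X` are the monomials `x^n`
  have hXpow : ∀ n : ℤ, X ^ n =
      algebraMap (AddMonoidAlgebra k (Fin 1 → ℤ)) K (single (fun _ : Fin 1 => n) (1 : k)) := by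
    intro n
    induction n using Int.induction_on with
    | zero =>
      rw [zpow_zero]
      exact (map_one _).symm
    | succ n ih =>
      rw [zpow_add_one₀ hX0, ih, hX, ← map_mul, single_mul_single, one_mul]
      rfl
    | pred n ih =>
      rw [zpow_sub_one₀ hX0, ih, mul_inv_eq_iff_eq_mul₀ hX0, hX, ← map_mul, single_mul_single,
        one_mul]
      congr 2
      funext i
      simp
  -- multiply the relation by `(X − 1)^(−μ₀)`: all exponents of `X − 1` become natural numbers
  have h2 : algebraMap (AddMonoidAlgebra k (Fin 1 → ℤ)) K (∑ v ∈ S, single (0 : Fin 1 → ℤ) (c v) *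
      (single (fun _ : Fin 1 => v (Fin.castAdd 1 0)) (1 : k) *
        (single (1 : Fin 1 → ℤ) (1 : k) - 1) ^ (v (Fin.natAdd 1 0) - μ₀).toNat)) = 0 := by
    have h' := congrArg (fun t => (X - 1) ^ (-μ₀) * t) h
    simp only [mul_zero, Finset.mul_sum] at h'
    rw [map_sum, ← h']
    refine Finset.sum_congr rfl fun v hv => ?_
    have hto : (((v (Fin.natAdd 1 0) - μ₀).toNat : ℕ) : ℤ) = -μ₀ + v (Fin.natAdd 1 0) := by
      rw [Int.toNat_of_nonneg (sub_nonneg.2 (hμ v hv))]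
      ring
    rw [map_mul, map_mul, map_pow, map_sub, map_one, ← hXpow, ← hX, ← zpow_natCast, hto,
      zpow_add₀ hU0]
    ring
  have h3 : ∑ v ∈ S, single (0 : Fin 1 → ℤ) (c v) *
      (single (fun _ : Fin 1 => v (Fin.castAdd 1 0)) (1 : k) *
        (single (1 : Fin 1 → ℤ) (1 : k) - 1) ^ (v (Fin.natAdd 1 0) - μ₀).toNat) = 0 :=
    hinj (by rw [h2, map_zero])
  exact inductiveStep_leg_bottom_layer_sum_eq_zero k S c μ₀ hμ h3


/-- The weight `w = (0, 1)` on `k[x^±, z^±] = k[ℤ^(1+1)]` weighs an exponent `v` by its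
`z`-component `v₁`. [folklore] -/
theorem inductiveStep_leg_dotWeight (v : Fin (1 + 1) → ℤ) :
    dotWeight (Fin.append (0 : Fin 1 → ℤ) (1 : Fin 1 → ℤ)) v = v (Fin.natAdd 1 0) := by
  rw [dotWeight_apply, Fin.sum_univ_add]
  simp only [Fin.append_left, Fin.append_right, Pi.zero_apply, Pi.one_apply, zero_mul, one_mul,
    Finset.sum_const_zero, zero_add, Fin.sum_univ_one]

set_option maxHeartbeats 800000 in
/-- **The leg of a tropical modification, in the route's inlined terms (main lemma).** Take `N = 1`,
`m = 1`, `I = ⊥ ⊆ k[x^±]` (so `U = 𝔾_m`: a prime ideal of dimension `1`), the single unit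
`G₀ = x − 1 ∉ I`, and the weight `w = (0, 1)` on `k[x^±, z^±] = k[ℤ^(1+1)]` (`z = y₀` the new variable).
Then every element of the route's initial ideal `in_w(I')`, `I' = ⟨ι(⊥), z − ι(x − 1)⟩ = ⟨z − x + 1⟩`,
dies under ANY `k`-algebra map `Ψ : k[x^±, z^±] → k[z^±]` with `x ↦ 1`, `z ↦ z`:
`in_w(I') ≤ ker Ψ` (in fact `in_w(I') = ⟨x − 1⟩ = ker Ψ`, the initial degeneration `{1} × 𝔾_m` of the
LEG of `Trop(U[G⁻¹])` in direction `(0, 1)` — the tropicalisation of the valuation `ord_{x=1}`, for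
which `val(x − 1) = 1 > 0 = min(val x, val 1)`: cancellation). Proof: every `f ∈ I'` dies under
`x ↦ X, z ↦ X − 1` into `Frac k[X^±]`; by the `(X − 1)`-adic order the bottom `w`-layer of `f` has
coefficient sum `0` (`inductiveStep_leg_layer_sum_eq_zero`), i.e. `Ψ(in_w f) = 0`. [folklore] -/
theorem inductiveStep_leg_inIdeal_le_ker (k : Type) [Field k]
    (Ψ : AddMonoidAlgebra k (Fin (1 + 1) → ℤ) →ₐ[k] AddMonoidAlgebra k (Fin 1 → ℤ))
    (hΨ : ∀ (v : Fin (1 + 1) → ℤ) (a : k),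
      Ψ (single v a) = single (fun i : Fin 1 => v (Fin.natAdd 1 i)) a) :
    Ideal.span ((fun f : AddMonoidAlgebra k (Fin (1 + 1) → ℤ) => AddMonoidAlgebra.ofCoeff (f.coeff.filter fun v => ∀ u ∈ f.coeff.support, ∑ i, (Fin.append (0 : Fin 1 → ℤ) (1 : Fin 1 → ℤ)) i * v i ≤ ∑ i, (Fin.append (0 : Fin 1 → ℤ) (1 : Fin 1 → ℤ)) i * u i)) '' (↑(Ideal.span ((fun f : AddMonoidAlgebra k (Fin 1 → ℤ) => (AddMonoidAlgebra.ofCoeff (f.coeff.mapDomain fun v => Fin.append v (0 : Fin 1 → ℤ)) : AddMonoidAlgebra k (Fin (1 + 1) → ℤ))) '' (↑(⊥ : Ideal (AddMonoidAlgebra k (Fin 1 → ℤ))) : Set (AddMonoidAlgebra k (Fin 1 → ℤ))) ∪ Set.range (fun j : Fin 1 => AddMonoidAlgebra.single (Fin.append (0 : Fin 1 → ℤ) (Pi.single j (1 : ℤ))) (1 : k) - AddMonoidAlgebra.ofCoeff ((AddMonoidAlgebra.single (1 : Fin 1 → ℤ) (1 : k) - 1 : AddMonoidAlgebra k (Fin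 1 → ℤ)).coeff.mapDomain fun v => Fin.append v (0 : Fin 1 → ℤ))))) : Set (AddMonoidAlgebra k (Fin (1 + 1) → ℤ)))) ≤ RingHom.ker Ψ.toRingHom := by
  -- the generating set `T` of `I'` and the weight are made opaque
  generalize hT : ((fun f : AddMonoidAlgebra k (Fin 1 → ℤ) => (AddMonoidAlgebra.ofCoeff (f.coeff.mapDomain fun v => Fin.append v (0 : Fin 1 → ℤ)) : AddMonoidAlgebra k (Fin (1 + 1) → ℤ))) '' (↑(⊥ : Ideal (AddMonoidAlgebra k (Fin 1 → ℤ))) : Set (AddMonoidAlgebra k (Fin 1 → ℤ))) ∪ Set.range (fun j : Fin 1 => AddMonoidAlgebra.single (Fin.append (0 : Fin 1 → ℤ) (Pi.single j (1 : ℤ))) (1 : k) - AddMonoidAlgebra.ofCoeff ((AddMonoidAlgebra.single (1 : Fin 1 → ℤ) (1 : k) - 1 : AddMonoidAlgebra k (Fin 1 → ℤ)).coeff.mapDomain fun v => Fin.append v (0 : Fin 1 → ℤ)))) = T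
  generalize hw : (Fin.append (0 : Fin 1 → ℤ) (1 : Fin 1 → ℤ)) = w
  refine le_trans (Eq.le (tropicalLinks_weightInitialIdeal_eq_span w (Ideal.span T) _).symm) ?_
  -- the algebra map `θ : k[x^±,z^±] → Frac k[X^±]` (`x ↦ X`, `z ↦ X − 1`)
  set K := FractionRing (AddMonoidAlgebra k (Fin 1 → ℤ)) with hK
  have hinj : Function.Injective (algebraMap (AddMonoidAlgebra k (Fin 1 → ℤ)) K) :=
    IsFractionRing.injective (AddMonoidAlgebra k (Fin 1 → ℤ)) K
  set xR : (AddMonoidAlgebra k (Fin 1 → ℤ)) := single (1 : Fin 1 → ℤ) (1 : k) with hxR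
  set X : K := algebraMap (AddMonoidAlgebra k (Fin 1 → ℤ)) K xR with hX
  have hX0 : X ≠ 0 := by
    intro h0
    have h1 : xR = 0 := hinj (by rw [map_zero]; exact h0)
    rw [hxR, single_eq_zero] at h1
    exact one_ne_zero h1
  have hU0 : X - 1 ≠ 0 := by
    intro h0
    have h1 : xR = 1 := hinj (by rw [map_one]; exact sub_eq_zero.1 h0)
    have h2 := congrArg (fun g : (AddMonoidAlgebra k (Fin 1 → ℤ)) => g.coeff (1 : Fin 1 → ℤ)) h1
    have h10 : (1 : Fin 1 → ℤ) ≠ 0 := fun h => one_ne_zero (congrFun h 0)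
    simp only [hxR, one_def, coeff_single, Finsupp.single_eq_same] at h2
    rw [Finsupp.single_eq_of_ne h10] at h2
    exact one_ne_zero h2
  let φ₀ : Multiplicative (Fin (1 + 1) → ℤ) →* K :=
    { toFun := fun v => X ^ (Multiplicative.toAdd v (Fin.castAdd 1 0)) *
        (X - 1) ^ (Multiplicative.toAdd v (Fin.natAdd 1 0))
      map_one' := by simp
      map_mul' := fun a b => by
        simp only [toAdd_mul, Pi.add_apply, zpow_add₀ hX0, zpow_add₀ hU0]
        ring }
  have hφ₀ : ∀ v : Fin (1 + 1) → ℤ, φ₀ (Multiplicative.ofAdd v) =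
      X ^ (v (Fin.castAdd 1 0)) * (X - 1) ^ (v (Fin.natAdd 1 0)) := fun v => rfl
  clear_value φ₀
  set θ : AddMonoidAlgebra k (Fin (1 + 1) → ℤ) →ₐ[k] K :=
    AddMonoidAlgebra.lift k K (Fin (1 + 1) → ℤ) φ₀ with hθ
  have hθ_single : ∀ (v : Fin (1 + 1) → ℤ) (a : k), θ (single v a) =
      a • (X ^ (v (Fin.castAdd 1 0)) * (X - 1) ^ (v (Fin.natAdd 1 0))) := by
    intro v a
    rw [hθ, lift_single, hφ₀]
  -- (1) `I' ≤ ker θ`: both kinds of generators die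
  have hTθ : Ideal.span T ≤ RingHom.ker θ.toRingHom := by
    rw [Ideal.span_le, ← hT]
    rintro t (⟨f, hf, rfl⟩ | ⟨j, rfl⟩)
    · have hf0 : f = 0 := by simpa using hf
      subst hf0
      simp only [SetLike.mem_coe, RingHom.mem_ker, AlgHom.toRingHom_eq_coe, RingHom.coe_coe]
      rw [coeff_zero, Finsupp.mapDomain_zero, ofCoeff_zero, map_zero]
    · obtain rfl : j = 0 := Fin.fin_one_eq_zero j
      simp only [SetLike.mem_coe, RingHom.mem_ker, AlgHom.toRingHom_eq_coe, RingHom.coe_coe]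
      have hcoeff : (single (1 : Fin 1 → ℤ) (1 : k) - 1 : (AddMonoidAlgebra k (Fin 1 → ℤ))).coeff =
          Finsupp.single 1 1 - Finsupp.single 0 1 := rfl
      rw [hcoeff, Finsupp.mapDomain_sub, Finsupp.mapDomain_single, Finsupp.mapDomain_single]
      rw [show (AddMonoidAlgebra.ofCoeff (Finsupp.single (Fin.append (1 : Fin 1 → ℤ) (0 : Fin 1 → ℤ)) (1 : k) -
          Finsupp.single (Fin.append (0 : Fin 1 → ℤ) (0 : Fin 1 → ℤ)) (1 : k)) : AddMonoidAlgebra k (Fin (1 + 1) → ℤ)) =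
          single (Fin.append (1 : Fin 1 → ℤ) (0 : Fin 1 → ℤ)) (1 : k) -
            single (Fin.append (0 : Fin 1 → ℤ) (0 : Fin 1 → ℤ)) (1 : k) from rfl]
      rw [map_sub, map_sub, hθ_single, hθ_single, hθ_single]
      simp only [one_smul, Fin.append_left, Fin.append_right, Pi.zero_apply, Pi.one_apply,
        Pi.single_eq_same, zpow_zero, zpow_one, one_mul, mul_one]
      ring
  -- (2) for `f ∈ I'`, the initial form dies under `Ψ`
  have hkey : ∀ f ∈ Ideal.span T, Ψ (initialForm (dotWeight w) f) = 0 := by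
    intro f hf
    by_cases hf0 : f = 0
    · subst hf0
      rw [initialForm_zero, map_zero]
    have hS : f.coeff.support.Nonempty := by
      rw [Finsupp.support_nonempty_iff, Ne, coeff_eq_zero]
      exact hf0
    -- `θ f = 0`, expanded over the support
    have hθf : θ f = 0 := hTθ hf
    rw [hθ, lift_apply, Finsupp.sum] at hθf
    simp only [hφ₀] at hθf
    have hθf' : ∑ v ∈ f.coeff.support, algebraMap (AddMonoidAlgebra k (Fin 1 → ℤ)) K (single (0 : Fin 1 → ℤ) (f.coeff v)) *
        (X ^ (v (Fin.castAdd 1 0)) * (X - 1) ^ (v (Fin.natAdd 1 0))) = 0 := by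
      rw [← hθf]
      refine Finset.sum_congr rfl fun v _ => ?_
      rw [Algebra.smul_def, IsScalarTower.algebraMap_apply k (AddMonoidAlgebra k (Fin 1 → ℤ)) K]
      simp only [coe_algebraMap, Algebra.algebraMap_self, RingHom.coe_id, Function.comp_apply, id_eq]
    have hsum := inductiveStep_leg_layer_sum_eq_zero k K hinj f.coeff.support hS (fun v => f.coeff v) hθf'
    -- the initial form keeps exactly the bottom layer `v₁ = μ₀`
    set μ₀ := f.coeff.support.inf' hS (fun v => v (Fin.natAdd 1 0)) with hμ₀
    have hP : ∀ v ∈ f.coeff.support, ((∀ u ∈ f.coeff.support, dotWeight w v ≤ dotWeight w u) ↔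
        v (Fin.natAdd 1 0) = μ₀) := by
      intro v hv
      simp only [← hw, inductiveStep_leg_dotWeight]
      constructor
      · intro hall
        exact le_antisymm (Finset.le_inf' hS _ hall) (Finset.inf'_le _ hv)
      · intro heq u hu
        rw [heq]
        exact Finset.inf'_le _ hu
    rw [lift_unique Ψ, Finsupp.sum, support_initialForm]
    simp only [hΨ]
    have hfilter : f.coeff.support.filter (fun v => ∀ u ∈ f.coeff.support, dotWeight w v ≤ dotWeight w u) =
        f.coeff.support.filter (fun v => v (Fin.natAdd 1 0) = μ₀) := Finset.filter_congr hP
    rw [hfilter]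
    have hterm : ∀ v ∈ f.coeff.support.filter (fun v => v (Fin.natAdd 1 0) = μ₀),
        (initialForm (dotWeight w) f).coeff v • single (fun i : Fin 1 => v (Fin.natAdd 1 i)) (1 : k) =
          f.coeff v • single (fun _ : Fin 1 => μ₀) (1 : k) := by
      intro v hv
      rw [Finset.mem_filter] at hv
      rw [coeff_initialForm_apply, if_pos ((hP v hv.1).2 hv.2)]
      congr 2
      funext i
      rw [Fin.fin_one_eq_zero i, hv.2]
    rw [Finset.sum_congr rfl hterm, ← Finset.sum_smul, hsum, zero_smul]
  -- (3) conclude: `in_w(I') ≤ ker Ψ`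
  rw [weightInitialIdeal, initialIdeal, Ideal.span_le]
  rintro _ ⟨f, hf, rfl⟩
  exact hkey f hf

/-- The substitution `x ↦ 1`, `z ↦ z` exists as a `k`-algebra map `k[x^±, z^±] → k[z^±]`. [folklore] -/
theorem inductiveStep_leg_exists_subst (k : Type) [Field k] :
    ∃ Ψ : AddMonoidAlgebra k (Fin (1 + 1) → ℤ) →ₐ[k] AddMonoidAlgebra k (Fin 1 → ℤ),
      ∀ (v : Fin (1 + 1) → ℤ) (a : k), Ψ (single v a) = single (fun i : Fin 1 => v (Fin.natAdd 1 i)) a := by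
  let ψ₀ : Multiplicative (Fin (1 + 1) → ℤ) →* AddMonoidAlgebra k (Fin 1 → ℤ) :=
    { toFun := fun v => single (fun i : Fin 1 => Multiplicative.toAdd v (Fin.natAdd 1 i)) (1 : k)
      map_one' := by
        simp only [toAdd_one, Pi.zero_apply]
        rfl
      map_mul' := fun a b => by
        rw [single_mul_single, one_mul]
        rfl }
  refine ⟨AddMonoidAlgebra.lift k (AddMonoidAlgebra k (Fin 1 → ℤ)) (Fin (1 + 1) → ℤ) ψ₀, fun v a => ?_⟩
  rw [lift_single]
  change a • single (fun i : Fin 1 => v (Fin.natAdd 1 i)) (1 : k) = _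
  rw [smul_single', mul_one]

end Summit.ResolutionOfSingularities.ResolutionOfSingularities.Theorems.InductiveStep.Negative
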